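import Mathlib.Analysis.SpecialFunctions.Pow.Asymptotics
import Mathlib.Analysis.SpecialFunctions.Log.Basic
import HarnessLib

/-!
# Sub-goal `fv_mixing_params` of the lead's stub `stub_hsFreeEnergyConvex` (line
# `IdeatorTwoGen1Sketch`, crux `MacroClosure`, stmt-AtomisticToContinuum-14870) — helpers A

Support file (`--supports stmt-AtomisticToContinuum-14870`) for the registered sub-goal
`Barycentric.fv_mixing_params` (S5, mixing parameters of the sub-cube decomposition lower bound of
the hard-sphere free volume: a `k³` grid, `k = ⌊N^{1/15}⌋₊ + 2`, of cubes of side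
`s = 1/k - (η/N)^{1/3}`, `J₁` cubes at local density `≤ η₁`, `J₂` at `≤ η₂`, one fractional and one
overflow cube).  Pure real analysis of the explicit bookkeeping, in the namespace
`Barycentric.FvMixingParams` (but for the last item):

* `exists_delta` — choice of the small parameter `δ`;
* `rpow_pow_fifteen`, `rpow_third_pow_three` — `(N^{1/15})^15 = N`, `(x^{1/3})^3 = x`;
* `poly_bounds` — from `t = N^{1/15} ≥ T₀` and `k ∈ [t, t + 2]`: `η k¹² ≤ δ³ N`, `k⁶ ≤ δ N`,
  `1/k ≤ δ`, `k³ (log N + 2) ≤ ε N`;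
* `env` — the corridor algebra: `0 < s`, `1 - 3dk ≤ (ks)³ ≤ 1`, `(ks)³ ≥ 1/8`, `δ s³ N ≥ 1`, …;
* `jfacts` — `J₁ = ⌊α (k³ - 1)⌋₊` satisfies `J₁ + 2 ≤ k³`, `J₁ ≤ α (k³ - 1) < J₁ + 1`;
* `overflow` — the three bounds `R η ≤ (6/5) s³N`, `R ≤ 2 s³ N`, `R ≤ ε N` on the overflow cell;
* `fv_mixing_params_weight` (registered helper sub-goal, namespace `Barycentric`) — the
  entropy-of-mixing weight `|J n / N - β ηᵢ / η| ≤ ε`.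
-/

noncomputable section

open Filter Set Topology

namespace Summit.AtomisticToContinuum.HydrodynamicLimit.Theorems.MacroClosureLine

namespace Barycentric

namespace FvMixingParams

/-- Choice of the small parameter `δ` of the bookkeeping. -/
theorem exists_delta (η₁ η₂ ε : ℝ) (N₀ : ℕ) (h₁ : 0 < η₁) (h₂ : 0 < η₂) (hε : 0 < ε) :
    ∃ δ : ℝ, 0 < δ ∧ δ ≤ 1 / 352 ∧ 6 * δ ≤ ε ∧ δ * (N₀ + 2) * η₂ ≤ η₁ ∧
      6 * δ * η₂ ≤ ε * η₁ := by
  set δ : ℝ := min (1 / 352) (min (ε / 6) (min (η₁ / ((N₀ + 2) * η₂)) (ε * η₁ / (6 * η₂))))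
    with hδ
  refine ⟨δ, by positivity, min_le_left _ _, ?_, ?_, ?_⟩
  · have : δ ≤ ε / 6 := le_trans (min_le_right _ _) (min_le_left _ _)
    linarith
  · have : δ ≤ η₁ / ((N₀ + 2) * η₂) :=
      le_trans (min_le_right _ _) (le_trans (min_le_right _ _) (min_le_left _ _))
    rw [le_div_iff₀ (by positivity)] at this
    linarith
  · have : δ ≤ ε * η₁ / (6 * η₂) :=
      le_trans (min_le_right _ _) (le_trans (min_le_right _ _) (min_le_right _ _))
    rw [le_div_iff₀ (by positivity)] at this
    linarith

/-- `(N^{1/15})^15 = N`. -/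
theorem rpow_pow_fifteen (N : ℕ) :
    0 ≤ (N : ℝ) ^ (1 / 15 : ℝ) ∧ ((N : ℝ) ^ (1 / 15 : ℝ)) ^ 15 = N := by
  refine ⟨Real.rpow_nonneg (Nat.cast_nonneg N) _, ?_⟩
  rw [← Real.rpow_natCast, ← Real.rpow_mul (Nat.cast_nonneg N)]
  norm_num

/-- `(x^{1/3})^3 = x` for `0 ≤ x`. -/
theorem rpow_third_pow_three (x : ℝ) (hx : 0 ≤ x) : (x ^ (1 / 3 : ℝ)) ^ 3 = x := by
  rw [← Real.rpow_natCast, ← Real.rpow_mul hx]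
  norm_num

/-- Polynomial consequences of `t = N^{1/15} ≥ T₀` for `k ∈ [t, t + 2]`, `N = t¹⁵`. -/
theorem poly_bounds (t k N δ ε η T₀ : ℝ) (hδ : 0 < δ) (hε : 0 < ε) (hη2 : η < 2)
    (hT1 : 1 ≤ T₀) (hTδ : 1062882 / δ ≤ T₀) (hTε : 405 / ε ≤ T₀) (ht : T₀ ≤ t)
    (hkhi : k ≤ t + 2) (hklo : t ≤ k) (hN : N = t ^ 15) :
    η * k ^ 12 ≤ δ ^ 3 * N ∧ k ^ 6 ≤ δ * N ∧ 1 / k ≤ δ ∧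
      k ^ 3 * (Real.log N + 2) ≤ ε * N := by
  have ht1 : 1 ≤ t := le_trans hT1 ht
  have ht0 : 0 < t := by linarith
  have hk0 : 0 < k := by linarith
  have hk3t : k ≤ 3 * t := by linarith
  have hδt : 1062882 ≤ δ * t := by
    have h := le_trans hTδ ht
    rw [div_le_iff₀ hδ] at h
    linarith
  have hεt : 405 ≤ ε * t := by
    have h := le_trans hTε ht
    rw [div_le_iff₀ hε] at h
    linarith
  have hpow : ∀ m n : ℕ, m ≤ n → t ^ m ≤ t ^ n := fun m n h => pow_le_pow_right₀ ht1 h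
  refine ⟨?_, ?_, ?_, ?_⟩
  · have a1 : k ^ 12 ≤ (3 * t) ^ 12 := pow_le_pow_left₀ hk0.le hk3t 12
    have a2 : η * k ^ 12 ≤ 2 * (3 * t) ^ 12 :=
      mul_le_mul hη2.le a1 (by positivity) (by norm_num)
    have a3 : (2 : ℝ) * (3 * t) ^ 12 = 1062882 * t ^ 12 := by ring
    have a4 : 1062882 * t ^ 12 ≤ δ * t * t ^ 12 :=
      mul_le_mul_of_nonneg_right hδt (by positivity)
    have a5 : δ * t ≤ (δ * t) ^ 3 := by
      have h1 : 1 ≤ δ * t := by linarith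
      calc δ * t = (δ * t) * 1 := by ring
        _ ≤ (δ * t) * (δ * t) ^ 2 :=
            mul_le_mul_of_nonneg_left (one_le_pow₀ h1) (by positivity)
        _ = (δ * t) ^ 3 := by ring
    have a6 : δ * t * t ^ 12 ≤ (δ * t) ^ 3 * t ^ 12 :=
      mul_le_mul_of_nonneg_right a5 (by positivity)
    calc η * k ^ 12 ≤ 1062882 * t ^ 12 := by linarith
      _ ≤ (δ * t) ^ 3 * t ^ 12 := by linarith
      _ = δ ^ 3 * N := by rw [hN]; ring
  · have a1 : k ^ 6 ≤ (3 * t) ^ 6 := pow_le_pow_left₀ hk0.le hk3t 6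
    have a2 : (3 * t) ^ 6 = 729 * t ^ 6 := by ring
    have a3 : t ^ 6 ≤ t ^ 14 := hpow 6 14 (by norm_num)
    have a4 : 729 * t ^ 14 ≤ δ * t * t ^ 14 :=
      mul_le_mul_of_nonneg_right (by linarith) (by positivity)
    calc k ^ 6 ≤ 729 * t ^ 14 := by linarith
      _ ≤ δ * t * t ^ 14 := a4
      _ = δ * N := by rw [hN]; ring
  · rw [div_le_iff₀ hk0]
    have : δ * t ≤ δ * k := mul_le_mul_of_nonneg_left hklo hδ.le
    linarith
  · have hlogN : Real.log N = 15 * Real.log t := by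
      rw [hN, Real.log_pow]; norm_num
    have hlogt : Real.log t ≤ t - 1 := Real.log_le_sub_one_of_pos ht0
    have hlogt0 : 0 ≤ Real.log t := Real.log_nonneg ht1
    have a1 : k ^ 3 ≤ (3 * t) ^ 3 := pow_le_pow_left₀ hk0.le hk3t 3
    have a2 : 0 ≤ Real.log N + 2 := by rw [hlogN]; linarith
    have a3 : Real.log N + 2 ≤ 15 * t := by rw [hlogN]; linarith
    have a4 : k ^ 3 * (Real.log N + 2) ≤ (3 * t) ^ 3 * (15 * t) :=
      mul_le_mul a1 a3 a2 (by positivity)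
    have a5 : (3 * t) ^ 3 * (15 * t) = 405 * t ^ 4 := by ring
    have a6 : t ^ 4 ≤ t ^ 14 := hpow 4 14 (by norm_num)
    have a7 : 405 * t ^ 14 ≤ ε * t * t ^ 14 :=
      mul_le_mul_of_nonneg_right hεt (by positivity)
    calc k ^ 3 * (Real.log N + 2) ≤ 405 * t ^ 4 := by linarith
      _ ≤ 405 * t ^ 14 := by linarith
      _ ≤ ε * t * t ^ 14 := a7
      _ = ε * N := by rw [hN]; ring

/-- The corridor algebra: with `u = d k ≤ δ ≤ 1/352`, `k s = 1 - u`, so `0 < s`,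
`1 - 3u ≤ (ks)³ ≤ 1`, `(ks)³ ≥ 1/8`, and the consequences used by the bookkeeping. -/
theorem env (k d δ N s : ℝ) (hk : 2 ≤ k) (hd : 0 ≤ d) (hδ : 0 < δ) (hδ1 : δ ≤ 1 / 352)
    (hdk : d * k ^ 4 ≤ δ) (hk6 : k ^ 6 ≤ δ * N) (hk1 : 1 / k ≤ δ) (hs : s = 1 / k - d) :
    0 < N ∧ 0 < s ∧ d * k ≤ δ ∧ k ^ 3 * (s ^ 3 * N) ≤ N ∧
      N ≤ k ^ 3 * (s ^ 3 * N) + 3 * δ * N ∧ N ≤ 8 * k ^ 3 * (s ^ 3 * N) ∧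
      1 ≤ δ * (s ^ 3 * N) ∧ s ^ 3 * N ≤ δ * N ∧ k ^ 3 ≤ δ * N ∧
      N ≤ k ^ 3 * (s ^ 3 * N) + 3 * (d * k) * N := by
  have hk0 : 0 < k := by linarith
  have hk1' : 1 ≤ k := by linarith
  have hN : 0 < N := by
    have h1 : 0 < k ^ 6 := by positivity
    have h2 : 0 < δ * N := lt_of_lt_of_le h1 hk6
    exact pos_of_mul_pos_right h2 hδ.le
  have hk3 : (1 : ℝ) ≤ k ^ 3 := one_le_pow₀ hk1'
  have hk38 : (8 : ℝ) ≤ k ^ 3 := by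
    have := pow_le_pow_left₀ (by norm_num : (0 : ℝ) ≤ 2) hk 3
    norm_num at this
    exact this
  have hdkδ : d * k ≤ δ := by
    have h1 : d * k ≤ d * k ^ 4 := by
      have h2 : 0 ≤ d * k := mul_nonneg hd hk0.le
      calc d * k = d * k * 1 := by ring
        _ ≤ d * k * k ^ 3 := mul_le_mul_of_nonneg_left hk3 h2
        _ = d * k ^ 4 := by ring
    linarith
  set u := d * k with hu
  have hu0 : 0 ≤ u := mul_nonneg hd hk0.le
  have hu1 : u ≤ 1 / 352 := by linarith
  have hks : k * s = 1 - u := by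
    rw [hs, hu]; field_simp
  have hs0 : 0 < s := by
    have h1 : 0 < k * s := by rw [hks]; linarith
    exact pos_of_mul_pos_right h1 hk0.le
  have hS : k ^ 3 * (s ^ 3 * N) = (1 - u) ^ 3 * N := by rw [← hks]; ring
  have hp1 : (1 - u) ^ 3 ≤ 1 := pow_le_one₀ (by linarith) (by linarith)
  have hp2 : 1 - 3 * u ≤ (1 - u) ^ 3 := by
    nlinarith [mul_nonneg (sq_nonneg u) (by linarith : (0 : ℝ) ≤ 3 - u)]
  have hp3 : (1 : ℝ) / 8 ≤ (1 - u) ^ 3 := by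
    have := pow_le_pow_left₀ (by norm_num : (0 : ℝ) ≤ 1 / 2) (by linarith : 1 / 2 ≤ 1 - u) 3
    norm_num at this
    linarith
  have e2 : k ^ 3 * (s ^ 3 * N) ≤ N := by
    rw [hS]; exact mul_le_of_le_one_left hN.le hp1
  have e3' : N ≤ k ^ 3 * (s ^ 3 * N) + 3 * u * N := by
    rw [hS]
    have := mul_le_mul_of_nonneg_right hp2 hN.le
    linarith
  have e3 : N ≤ k ^ 3 * (s ^ 3 * N) + 3 * δ * N := by
    have := mul_le_mul_of_nonneg_right hdkδ hN.le
    linarith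
  have e4 : N ≤ 8 * k ^ 3 * (s ^ 3 * N) := by
    rw [mul_assoc, hS]
    have := mul_le_mul_of_nonneg_right hp3 hN.le
    linarith
  have hS0 : 0 ≤ s ^ 3 * N := by positivity
  have e5 : 1 ≤ δ * (s ^ 3 * N) := by
    -- `8 k³ δ S ≥ δ N ≥ k⁶`, so `8 δ S ≥ k³ ≥ 8`.
    have h1 : k ^ 3 * k ^ 3 ≤ δ * (8 * k ^ 3 * (s ^ 3 * N)) := by
      calc k ^ 3 * k ^ 3 = k ^ 6 := by ring
        _ ≤ δ * N := hk6
        _ ≤ δ * (8 * k ^ 3 * (s ^ 3 * N)) := mul_le_mul_of_nonneg_left e4 hδ.le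
    have h2 : k ^ 3 * k ^ 3 ≤ 8 * (δ * (s ^ 3 * N)) * k ^ 3 := by linarith
    have h3 : k ^ 3 ≤ 8 * (δ * (s ^ 3 * N)) := le_of_mul_le_mul_right h2 (by positivity)
    linarith
  have e6 : s ^ 3 * N ≤ δ * N := by
    have hδk : 1 ≤ δ * k := by rwa [div_le_iff₀ hk0] at hk1
    have h1 : N ≤ δ * k ^ 3 * N := by
      have h2 : 1 ≤ δ * k ^ 3 := by
        calc (1 : ℝ) ≤ δ * k := hδk
          _ = δ * k * 1 := by ring
          _ ≤ δ * k * k ^ 2 := mul_le_mul_of_nonneg_left (one_le_pow₀ hk1') (by positivity)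
          _ = δ * k ^ 3 := by ring
      exact le_mul_of_one_le_left hN.le h2
    have h2 : (s ^ 3 * N) * k ^ 3 ≤ (δ * N) * k ^ 3 := by linarith
    exact le_of_mul_le_mul_right h2 (by positivity)
  have e7 : k ^ 3 ≤ δ * N := by
    calc k ^ 3 = k ^ 3 * 1 := by ring
      _ ≤ k ^ 3 * k ^ 3 := mul_le_mul_of_nonneg_left hk3 (by positivity)
      _ = k ^ 6 := by ring
      _ ≤ δ * N := hk6
  exact ⟨hN, hs0, hdkδ, e2, e3, e4, e5, e6, e7, e3'⟩

/-- `J₁ = ⌊α (k³ - 1)⌋₊` satisfies `J₁ + 2 ≤ k³` and `J₁ ≤ α (k³ - 1) < J₁ + 1`. -/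
theorem jfacts (α : ℝ) (k : ℕ) (hα : 0 < α) (hα₁ : α < 1) (hk : 2 ≤ k) :
    ⌊α * ((k : ℝ) ^ 3 - 1)⌋₊ + 2 ≤ k ^ 3 ∧
      (⌊α * ((k : ℝ) ^ 3 - 1)⌋₊ : ℝ) ≤ α * ((k : ℝ) ^ 3 - 1) ∧
      α * ((k : ℝ) ^ 3 - 1) < ⌊α * ((k : ℝ) ^ 3 - 1)⌋₊ + 1 := by
  have hk2 : (2 : ℝ) ≤ k := by exact_mod_cast hk
  have hk8 : (8 : ℝ) ≤ (k : ℝ) ^ 3 := by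
    have := pow_le_pow_left₀ (by norm_num : (0 : ℝ) ≤ 2) hk2 3
    norm_num at this
    exact this
  have hpos : 0 ≤ α * ((k : ℝ) ^ 3 - 1) := mul_nonneg hα.le (by linarith)
  have hfl := Nat.floor_le hpos
  have hlt := Nat.lt_floor_add_one (α * ((k : ℝ) ^ 3 - 1))
  refine ⟨?_, hfl, hlt⟩
  have h1 : α * ((k : ℝ) ^ 3 - 1) < (k : ℝ) ^ 3 - 1 := by nlinarith
  have h2 : (⌊α * ((k : ℝ) ^ 3 - 1)⌋₊ : ℝ) + 1 < ((k ^ 3 : ℕ) : ℝ) := by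
    push_cast; linarith
  have h3 : ⌊α * ((k : ℝ) ^ 3 - 1)⌋₊ + 1 < k ^ 3 := by exact_mod_cast h2
  omega

/-- The three bounds on the overflow occupation `R = N - T`. -/
theorem overflow (R T S N K u δ ε η : ℝ) (hη0 : 0 < η) (hη1 : η < 11 / 10) (hN : 0 ≤ N)
    (hK : 0 < K) (hS : 0 ≤ S) (hδ0 : 0 ≤ δ) (hδ1 : δ ≤ 1 / 352) (hδε : 6 * δ ≤ ε)
    (hR : R = N - T) (hT : (K - 1) * S - (K - 1) ≤ T) (hlow : N ≤ K * S + 3 * u * N)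
    (h8 : N ≤ 8 * K * S) (hu : u ≤ δ) (huK : u * K ≤ δ) (hK6 : K * K ≤ δ * N)
    (hSδ : S ≤ δ * N) (hKδ : K ≤ δ * N) :
    R * η ≤ 6 / 5 * S ∧ R ≤ 2 * S ∧ R ≤ ε * N := by
  have hRle : R ≤ 3 * u * N + S + K := by rw [hR]; linarith
  have hX : 8 * K * (3 * u * N + K) ≤ 8 * K * (32 * δ * S) := by
    have a1 : u * K * N ≤ δ * N := mul_le_mul_of_nonneg_right huK hN
    have a2 : 32 * δ * N ≤ 32 * δ * (8 * K * S) := mul_le_mul_of_nonneg_left h8 (by positivity)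
    nlinarith [a1, a2, hK6]
  have hX' : 3 * u * N + K ≤ 32 * δ * S := le_of_mul_le_mul_left hX (by positivity)
  refine ⟨?_, ?_, ?_⟩
  · have a1 : R * η ≤ (S + (3 * u * N + K)) * η := mul_le_mul_of_nonneg_right (by linarith) hη0.le
    have a2 : (3 * u * N + K) * η ≤ 32 * δ * S * η := mul_le_mul_of_nonneg_right hX' hη0.le
    have a3 : δ * η ≤ 1 / 320 := by nlinarith
    have a4 : 32 * S * (δ * η) ≤ 32 * S * (1 / 320) := mul_le_mul_of_nonneg_left a3 (by positivity)
    have a5 : S * η ≤ S * (11 / 10) := mul_le_mul_of_nonneg_left hη1.le hS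
    nlinarith [a1, a2, a4, a5]
  · have a1 : δ * S ≤ 1 / 352 * S := mul_le_mul_of_nonneg_right hδ1 hS
    nlinarith [hRle, hX', a1]
  · have a1 : u * N ≤ δ * N := mul_le_mul_of_nonneg_right hu hN
    nlinarith [mul_le_mul_of_nonneg_right hδε hN, mul_nonneg hδ0 hN]

end FvMixingParams

/-- The entropy-of-mixing weight of a family of `J ∈ [β(K-1) - 1, β(K-1)]` cells with
`n ∈ [ηᵢ M - 1, ηᵢ M]` particles each (`M η = S = s³ N`, `K = k³`): `|J n / N - β ηᵢ / η| ≤ ε`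
(registered helper sub-goal of `fv_mixing_params`, used for the `η₁`- and the `η₂`-cells). -/
theorem fv_mixing_params_weight : ∀ (J n M S N η ηᵢ β K δ ε : ℝ), 0 < η → 0 < N → 0 ≤ β →
    β ≤ 1 → 0 < ηᵢ → 0 ≤ δ → 0 ≤ J → β * (K - 1) - 1 ≤ J → J ≤ β * (K - 1) → n ≤ ηᵢ * M →
    ηᵢ * M - 1 ≤ n → 1 ≤ ηᵢ * M → M * η = S → 0 ≤ S → K * S ≤ N → N ≤ K * S + 3 * δ * N →
    S ≤ δ * N → K ≤ δ * N → δ * (5 * ηᵢ + η) ≤ ε * η → |J * n / N - β * ηᵢ / η| ≤ ε := by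
  intro J n M S N η ηᵢ β K δ ε hη hN hβ0 hβ1 hηi hδ hJ0 hJlo hJhi hnhi hnlo hM1 hMS hS0 hSN hlow hSδ
    hKδ hc
  have hε : 0 ≤ ε := by
    by_contra h
    have h' : ε < 0 := lt_of_not_ge h
    have : δ * (5 * ηᵢ + η) < 0 := lt_of_le_of_lt hc (mul_neg_of_neg_of_pos h' hη)
    have : 0 ≤ δ * (5 * ηᵢ + η) := mul_nonneg hδ (by linarith)
    linarith
  rw [abs_sub_le_iff]
  constructor
  · have h1 : J * n / N ≤ β * ηᵢ / η := by
      rw [div_le_div_iff₀ hN hη]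
      calc J * n * η ≤ J * (ηᵢ * M) * η := by gcongr
        _ = J * ηᵢ * S := by rw [← hMS]; ring
        _ ≤ β * (K - 1) * ηᵢ * S := by
            have := mul_nonneg hηi.le hS0
            nlinarith [mul_le_mul_of_nonneg_right hJhi this]
        _ = β * ηᵢ * (K * S - S) := by ring
        _ ≤ β * ηᵢ * N := mul_le_mul_of_nonneg_left (by linarith) (mul_nonneg hβ0 hηi.le)
    linarith
  · have hP : (β * (K - 1) - 1) * (ηᵢ * M - 1) ≤ J * n := by
      nlinarith [mul_nonneg hJ0 (sub_nonneg.2 hnlo), mul_nonneg (sub_nonneg.2 hJlo)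
        (sub_nonneg.2 hM1)]
    have hPη : (β * (K - 1) - 1) * (ηᵢ * M - 1) * η = (β * (K - 1) - 1) * (ηᵢ * S - η) := by
      rw [← hMS]; ring
    have t0 : (β * (K - 1) - 1) * (ηᵢ * M - 1) * η ≤ J * n * η :=
      mul_le_mul_of_nonneg_right hP hη.le
    have t1 : β * ηᵢ * (N - 3 * δ * N - δ * N) ≤ β * ηᵢ * (K * S - S) :=
      mul_le_mul_of_nonneg_left (by linarith) (mul_nonneg hβ0 hηi.le)
    have t2 : β * K * η ≤ β * (δ * N) * η :=
      mul_le_mul_of_nonneg_right (mul_le_mul_of_nonneg_left hKδ hβ0) hη.le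
    have t3 : ηᵢ * S ≤ ηᵢ * (δ * N) := mul_le_mul_of_nonneg_left hSδ hηi.le
    have t4 : δ * N * (4 * β * ηᵢ + β * η + ηᵢ) ≤ δ * N * (5 * ηᵢ + η) := by
      apply mul_le_mul_of_nonneg_left _ (mul_nonneg hδ hN.le)
      nlinarith [mul_le_mul_of_nonneg_right hβ1 hηi.le, mul_le_mul_of_nonneg_right hβ1 hη.le]
    have t5 : δ * (5 * ηᵢ + η) * N ≤ ε * η * N := mul_le_mul_of_nonneg_right hc hN.le
    have t6 : 0 ≤ β * η := mul_nonneg hβ0 hη.le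
    have h2 : (β * ηᵢ - ε * η) * N ≤ J * n * η := by nlinarith [t0, t1, t2, t3, t4, t5, t6, hPη]
    have h3 : (β * ηᵢ - ε * η) / η ≤ J * n / N := by
      rw [div_le_div_iff₀ hη hN]; linarith
    have h4 : (β * ηᵢ - ε * η) / η = β * ηᵢ / η - ε := by
      rw [sub_div, mul_div_cancel_right₀ _ hη.ne']
    linarith

end Barycentric

end Summit.AtomisticToContinuum.HydrodynamicLimit.Theorems.MacroClosureLine

end
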